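import Literature.IUT.HodgeTheaters.GoodLocalFrobenioidSigmaLift
import Literature.IUT.HodgeTheaters.GoodLocalFrobenioidTransporterSigma
import Literature.IUT.HodgeTheaters.GenuineFKitMergeInputsLiftsGammaInnerAtTerm
import Literature.AnabelianGeometry.AbsoluteAnabelian.AbsAnabUnitsTransportIntegers
import Literature.NumberTheory.GaloisRepresentations.ClosureValuation
import HarnessLib

/-!
# [IUTchI] Cor 5.3 (ii) at a GOOD nonarchimedean place: the surjectivity half `LiftsAll` of the model case at the (S1) slot of record
# is a THEOREM — EVERY transporter of `Π_v̲` (Γ-inner or not) lifts to a self-equivalence of the genuine `𝒞_v̲`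
# (abc-iut-w4-d047, row «LIFTSALL-ALL@GOOD» (iv); PROOF-ONLY over landed files)

S. Mochizuki, *Inter-universal Teichmüller theory I*, kurims manuscript (May 2020), §5 Corollary 5.3 (ii) p. 144 l. 13–15 («the natural map
`Isom(¹𝔉, ²𝔉) → Isom(¹𝔇, ²𝔇)` [cf. Remark 5.2.1, (i)] is bijective») with its printed proof p. 144 l. 33–34 («follows immediately from
[AbsTopIII], Proposition 3.2, (iv); [AbsTopIII], Proposition 4.2, (i)»); Def 3.1 (e)(f) pp. 62–63 ([IUTchI] Cor 5.3 (ii) p.144)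
[claim: Mochizuki2012, status: disputed] (D-0012 claim key; PROOFS ONLY over landed files; nothing of the series is asserted; no side is taken on
[IUTchIII] Cor. 3.12).  Also [cite: MochizukiFrdII2008, Ex 1.3 (ii) p.11] (transport functors `pull`, composed ON THE NOSE by abc-iut-w4-d058
`pull_comp`), [cite: MochizukiAbsAnab2004, Prop 1.2.1 (vi) p.10] (the anabelian units transport), [cite: NeukirchANT1999, Ch. II (4.8)]
(the valuation ring of `k̄` is the integral closure of that of `k`).

## What is proved (cell abc-iut, L5 HUB node `IUTchI:Cor5.3(ii)`)

abc-iut-L5-t16 reduced the OPEN surjectivity half of the Cor 5.3 (ii) model case at the genuine good slot to one self-equivalence of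
`𝒞_v̲` per transporter `n ∈ N_{Π_{C_F}}(Π_v̲)` (`goodLiftsAllAt_iff`, p501097) and proved the clause for the Γ-INNER transporters (p503506/p504062),
booking the others as needing «the F_v-semilinear action … (infrastructure, not in tree)».  Here the clause is proved for EVERY transporter, hence
**`InitialThetaData.liftsAll_goodStructureFunctorAt : LiftsAll (goodStructureFunctorAt …) (𝒟_v̲) (modelAutToCatAut … x)`** — by print's own route
[AbsTopIII] Prop 3.2 (iv): the transporter automorphism `φ_n` of `Π_v̲ = Π_{X̲→_K} ×_{G_F} Gal(K̄_v̲/K_v̲)` covers `β_n := galTransporter n` on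
`Gal(K̄_v̲/K_v̲)` (abc-iut-w4-d047 ★ p504734), the anabelian units transport `σ_n := sigmaTransporter n` (★ p505751, ONE CALL of abc-iut-L4-d3's
`Prop121vii.unitsTransport_holds`) is `β_n`-equivariant, multiplicative and INTEGRAL (`sigmaTransporter_integral`: abc-iut-L6-t13
`Prop121vii.isAbsInteger_iff_of_unitsTransport` + the dictionary `valuation_closure_le_one_iff_mem_absIntegers` between abc-iut-L5-t16's spectral-norm
valuation of `k̄` and the integral closure of `𝒪_k`, Neukirch II (4.8) = tree `mem_absIntegers_iff_spectralNorm_le_one`), so abc-iut-w4-d047's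
`SigmaLift.exists_selfEquivalence_liesUnder_pullSelfEquiv` (★ `GoodLocalFrobenioidSigmaLift`, over the L1 brick `PadicFrd.perfMulTransport` ★ p507212)
lifts `φ_{n⁻¹}` to a self-equivalence of `𝒞_v̲` over `pull φ_{n⁻¹}` = `E ∘ conj_n ∘ E⁻¹` ON THE NOSE (abc-iut-L5-t16's five-`pull` computation, verbatim).
* `exists_selfEquivalence_liesUnder_of_transporter` (generic place data `p k ι hinj hX`, seam `hG`) — for EVERY `n`, a self-equivalence `Ψ` with
  `Ψ ⋙ toBase = toBase ⋙ (E ∘ conj_n ∘ E⁻¹)` on the nose AND the `LiesUnder` witness;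
* `liftsAll_goodStructureFunctorAt` — AT racer C's `frobeniusGoodAt CG hA B I x hx` (good nonarchimedean `x`): **`LiftsAll` HOLDS**;
* `goodLiftAt_model_case_iff_rigidOverBase` — consequently the Cor 5.3 (ii) MODEL CASE at the (S1) slot («`α ↦ toD(α)` bijective») is EQUIVALENT
  to the single remaining input `RigidOverBase (frobeniusGoodAt …).toBase` (print's injectivity half; rigidity rows S2′∘S2c/R63 of abc-iut-L1-t7/L1-d6);
* §C (v2 APPEND, generic place data `p k ι hinj hX x hG`): `liftsAll_goodStructureFunctor` — **`LiftsAll` HOLDS for `goodStructureFunctor`** at ANY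
  presentation of the good place; `goodLift_model_case_iff_rigidOverBase` / `goodLift_model_case_of_rigidOverBase` — the model case at the
  upgraded slot `goodLiftToD` ↔ / ⟸ `RigidOverBase (D.goodLocalFrobenioidOfEmb p k ι hX).toBase`.
Binders: the kit's ∪ {I, x, hx, hxb} ∪ {n} (§C: the kit's ∪ {p, k, ι, hinj, hX, x, hG}); FACT unnamed 0 (all anabelian content by IMPORT of L4
kernel theorems); 0 def · 0 instance · 0 notation; typed ≠ proved beyond what is here; nothing here asserts abc proved or refuted.
-/

noncomputable section

namespace Literature.IUT.HodgeTheaters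

open CategoryTheory Opposite Literature.AnabelianGeometry.SemiGraphs Literature.AlgebraicGeometry.Frobenioids
open Literature.AnabelianGeometry.AbsoluteAnabelian Literature.NumberTheory.GaloisRepresentations
open scoped ValuativeRel

/-! ### §A. The integrality of the anabelian `σ_n` for abc-iut-L5-t16's valuation of `k̄` (spectral norm) -/

section Dictionary

variable (p : ℕ) [Fact p.Prime] (k : Type) [NontriviallyNormedField k] [CompleteSpace k] [IsUltrametricDist k]
  [NormedAlgebra ℚ_[p] k] [FiniteDimensional ℚ_[p] k]

/-- **Dictionary** between abc-iut-L5-t16's valuation of `k̄ = (ofComplete p k).Ω` (the spectral norm, `closureVal`) and the integral closure of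
`𝒪_k` in `k̄` (tree `absIntegers`): `v(x) ≤ 1 ↔ x ∈ 𝒪_{k̄}` — Neukirch II (4.8), tree `mem_absIntegers_iff_spectralNorm_le_one`.
[cite: NeukirchANT1999, Ch. II (4.8)] -/
theorem valuation_closure_le_one_iff_mem_absIntegers (x : AlgebraicClosure k) :
    @ValuativeRel.valuation (AlgebraicClosure k) _ (GaloisValDatum.ofComplete p k).valΩ x ≤ 1 ↔
      (letI := GaloisValDatum.normVal k; x ∈ absIntegers 𝒪[k] k) := by
  letI : ValuativeRel k := GaloisValDatum.normVal k
  letI : ValuativeRel (AlgebraicClosure k) := (GaloisValDatum.ofComplete p k).valΩ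
  have h1 : ValuativeRel.valuation (AlgebraicClosure k) x ≤ 1 ↔ x ≤ᵥ (1 : AlgebraicClosure k) := by
    rw [← (ValuativeRel.valuation (AlgebraicClosure k)).map_one, ← Valuation.Compatible.vle_iff_le]
  rw [h1]
  change @ValuativeRel.vle _ _ (GaloisValDatum.closureVal k) x 1 ↔ _
  rw [GaloisValDatum.closureVal_iff, spectralNorm_one, mem_integralClosure_iff]
  symm
  refine isIntegral_integer_iff_spectralNorm_le_one (w := ValuativeRel.valuation k) (L := AlgebraicClosure k) (fun y => ?_)
    (Algebra.IsIntegral.isIntegral x)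
  rw [← (ValuativeRel.valuation k).map_one, ← Valuation.Compatible.vle_iff_le, GaloisValDatum.normVal_iff, norm_one]

end Dictionary

namespace InitialThetaData

section Integral

variable {F K Fbar : Type} [Field F] [NumberField F] [Field K] [NumberField K] [Algebra F K]
  [Field Fbar] [Algebra F Fbar] [Algebra K Fbar] [IsScalarTower F K Fbar] [Normal K Fbar]
  {E : WeierstrassCurve F} [E.IsElliptic] {l : ℕ} {Pb : BadPlacePredicates K}
  (D : InitialThetaData F K Fbar E l Pb)
  (p : ℕ) [Fact p.Prime] (k : Type) [NontriviallyNormedField k] [CompleteSpace k] [IsUltrametricDist k]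
  [NormedAlgebra ℚ_[p] k] [FiniteDimensional ℚ_[p] k] [Algebra K k] (ι : Fbar →ₐ[K] AlgebraicClosure k)
  (hinj : Function.Injective (localToGF F k ι)) (hX : IsOpen (D.PiXarrow : Set D.PiC))

/-- **`σ_n` is INTEGRAL for the spectral-norm valuation of `k̄`**: `v(x) ≤ 1 → v(σ_n x) ≤ 1` (abc-iut-L6-t13 `Prop121vii.isAbsInteger_iff_of_unitsTransport`
from `preservesAbsUnits_/preservesUniformizers_sigmaTransporter`, through the dictionary). ([IUTchI] Cor 5.3 (ii) p.144) [claim: Mochizuki2012, status: disputed] -/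
theorem sigmaTransporter_integral
    (n : ↥(Subgroup.normalizer ((D.PiXarrow ⊓ (localToGF F k ι).range.comap D.augGF : Subgroup D.PiC) : Set D.PiC)))
    (x : (AlgebraicClosure k)ˣ)
    (hx : @ValuativeRel.valuation (AlgebraicClosure k) _ (GaloisValDatum.ofComplete p k).valΩ (x : AlgebraicClosure k) ≤ 1) :
    @ValuativeRel.valuation (AlgebraicClosure k) _ (GaloisValDatum.ofComplete p k).valΩ
      (D.sigmaTransporter p k ι hinj hX n x : AlgebraicClosure k) ≤ 1 := by
  letI : ValuativeRel k := GaloisValDatum.normVal k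
  haveI : IsNonarchimedeanLocalField k := GoodPlaceSigma.isNonarchimedeanLocalField p k
  rw [valuation_closure_le_one_iff_mem_absIntegers] at hx ⊢
  exact (Prop121vii.isAbsInteger_iff_of_unitsTransport (D.preservesAbsUnits_sigmaTransporter p k ι hinj hX n)
    (D.preservesUniformizers_sigmaTransporter p k ι hinj hX n) x).mp hx

end Integral


section Bridge

variable {F K Fbar : Type} [Field F] [NumberField F] [Field K] [NumberField K] [Algebra F K]
  [Field Fbar] [Algebra F Fbar] [Algebra K Fbar]
  {E : WeierstrassCurve F} [E.IsElliptic] {l : ℕ} {Pb : BadPlacePredicates K}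
  (D : InitialThetaData F K Fbar E l Pb) (H : Subgroup D.PiC) {Γ : Type} [Group Γ] (ρ : Γ →* (Fbar ≃ₐ[F] Fbar))
  (hρ : Function.Injective ρ)

/-- abc-iut-L5-t16's `transporterEnd n` and abc-iut-w4-d047's `transporterEquiv n` are the same map (both `e⁻¹ ∘ conj_n ∘ e`).
([IUTchI] Def 3.1 (e) p.62) [claim: Mochizuki2012, status: disputed] -/
theorem transporterEnd_apply_eq_transporterEquiv
    (n : ↥(Subgroup.normalizer (((H ⊓ ρ.range.comap D.augGF : Subgroup D.PiC)) : Set D.PiC))) (z : D.PiLoc H ρ) :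
    D.transporterEnd H ρ hρ n z = D.transporterEquiv H ρ hρ n z := by
  apply D.fstLoc_injective H ρ hρ
  rw [D.fstLoc_apply, D.fstLoc_apply, D.transporterEquiv_fst]
  exact D.coe_transporterEnd H ρ hρ n z

end Bridge

/-! ### §B. EVERY transporter lifts (generic place data), and `LiftsAll` at the merge term -/

section AtTerm

/-- A left inverse makes a homomorphism surjective. [folklore] -/
private theorem surj_of_comp_eq_id' {P Q : Type} [Group P] [Group Q] {φ : P →* Q} {ψ : Q →* P}
    (h : φ.comp ψ = MonoidHom.id Q) : Function.Surjective φ :=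
  fun x => ⟨ψ x, DFunLike.congr_fun h x⟩

variable {F K Fbar : Type} [Field F] [NumberField F] [Field K] [NumberField K] [Algebra F K]
  [Field Fbar] [Algebra F Fbar] [Algebra K Fbar]
  {E : WeierstrassCurve F} [E.IsElliptic] {l : ℕ} {Pb : BadPlacePredicates K}
  (D : InitialThetaData F K Fbar E l Pb) (CG : D.geom.pe.CuspGalois) (hS : D.CuspClassesNormaliserStable) [Fact l.Prime]
  (M : D.TorsionMonodromy) (hA : D.geom.pe.ArrowCoveringClaims)
  (hI : ∀ k ∈ D.geom.pe.inertia D.geom.pe.ε1, M.tau (D.geom.embK k) = 0)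
  (B : ∀ v, v ∈ D.indexCopyBad → D.BadPairAt v) (ΛBad : ∀ v (h : v ∈ D.indexCopyBad), D.LocalArrowLaw CG hS (B v h).H)
  (p : ℕ) [Fact p.Prime] (k : Type) [NontriviallyNormedField k] [CompleteSpace k] [IsUltrametricDist k]
  [NormedAlgebra ℚ_[p] k] [FiniteDimensional ℚ_[p] k] [Algebra K k] (ι : Fbar →ₐ[K] AlgebraicClosure k)
  [IsScalarTower F K Fbar] [Normal K Fbar]
  (hinj : Function.Injective (localToGF F k ι)) (hX : IsOpen (D.PiXarrow : Set D.PiC)) (x : D.IndexCopy)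
  (hG : (D.localDataOfBadPairs CG hS M hA hI B ΛBad x).H = D.PiXarrow ⊓ (localToGF F k ι).range.comap D.augGF)

include hinj hX hG in
/-- **EVERY TRANSPORTER LIFTS (generic place data).**  At the (S1) slot of record over `D.goodLocalFrobenioidOfEmb p k ι hX`, every transporter
`n ∈ N_{Π_{C_F}}(Π_v̲)` — Γ-inner OR NOT — has a self-equivalence `Ψ` of the genuine `𝒞_v̲` with `Ψ ⋙ toBase = toBase ⋙ (E ∘ conj_n ∘ E⁻¹)` ON THE NOSE
(`E = goodBaseEquiv`), in particular lying under `E ∘ conj_n ∘ E⁻¹` through `toBase`: the clause of `goodLift_model_case_iff`'s `LiftsAll` for `n`.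
Proof: `n⁻¹` read on `Π_{X̲→_K} ×_{G_F} Gal(k̄/k)` (abc-iut-L5-t16 `transporterEnd` = abc-iut-w4-d047 `transporterEquiv`) covers `galTransporter n⁻¹`;
`sigmaTransporter n` / `sigmaTransporter n⁻¹` are the mutually inverse equivariant integral σ's; `SigmaLift` lifts; the five `pull`s compose on the nose
(abc-iut-L5-t16's computation, verbatim). ([IUTchI] Cor 5.3 (ii) p.144) [claim: Mochizuki2012, status: disputed] -/
theorem exists_selfEquivalence_liesUnder_of_transporter
    (n : ↥(Subgroup.normalizer (((D.localDataOfBadPairs CG hS M hA hI B ΛBad x).H : Subgroup D.PiC) : Set D.PiC))) :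
    letI := GaloisValDatum.normVal k
    ∃ Ψ : (D.goodLocalFrobenioidOfEmb p k ι hX).Cv ≌ (D.goodLocalFrobenioidOfEmb p k ι hX).Cv,
      Ψ.functor ⋙ (D.goodLocalFrobenioidOfEmb p k ι hX).toBase =
          (D.goodLocalFrobenioidOfEmb p k ι hX).toBase ⋙
            (((D.goodBaseEquiv CG hS M hA hI B ΛBad p k ι hinj hX x hG).trans (PiTransport.conjSelfEquiv _ n)).trans
              (D.goodBaseEquiv CG hS M hA hI B ΛBad p k ι hinj hX x hG).symm).functor ∧
      Nonempty (CatIsomorphism.LiesUnder (D.goodLocalFrobenioidOfEmb p k ι hX).toBase (D.goodLocalFrobenioidOfEmb p k ι hX).toBase Ψ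
        (((D.goodBaseEquiv CG hS M hA hI B ΛBad p k ι hinj hX x hG).trans (PiTransport.conjSelfEquiv _ n)).trans
          (D.goodBaseEquiv CG hS M hA hI B ΛBad p k ι hinj hX x hG).symm)) := by
  letI := GaloisValDatum.normVal k
  haveI := Literature.IUT.HodgeTheaters.compactSpace_gal_algebraicClosure p k
  have hn' : ((n⁻¹ : ↥(Subgroup.normalizer (((D.localDataOfBadPairs CG hS M hA hI B ΛBad x).H : Subgroup D.PiC) : Set D.PiC))) : D.PiC) ∈
      Subgroup.normalizer (((D.PiXarrow ⊓ (localToGF F k ι).range.comap D.augGF : Subgroup D.PiC)) : Set D.PiC) := by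
    rw [← hG]
    exact (n⁻¹).2
  let m : ↥(Subgroup.normalizer (((D.PiXarrow ⊓ (localToGF F k ι).range.comap D.augGF : Subgroup D.PiC)) : Set D.PiC)) := ⟨_, hn'⟩
  have hH : (localToGF F k ι).range ≤ D.PiXarrow.map D.augGF := D.range_localToGF_le_map_PiXarrow ι
  -- the automorphism of `Π_{X̲→_K} ×_{G_F} Gal(k̄/k)` attached to `m = n⁻¹` and its inverse
  let φ := D.transporterEnd D.PiXarrow (localToGF F k ι) hinj m
  let ψ := D.transporterEnd D.PiXarrow (localToGF F k ι) hinj m⁻¹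
  have hφc : Continuous φ := D.continuous_transporterEnd D.PiXarrow (localToGF F k ι) hinj hX (continuous_localToGF F k ι) m
  have hψc : Continuous ψ := D.continuous_transporterEnd D.PiXarrow (localToGF F k ι) hinj hX (continuous_localToGF F k ι) m⁻¹
  have h₁ : φ.comp ψ = MonoidHom.id _ := D.transporterEnd_comp_inv D.PiXarrow (localToGF F k ι) hinj m
  have h₂ : ψ.comp φ = MonoidHom.id _ := D.transporterEnd_inv_comp D.PiXarrow (localToGF F k ι) hinj m
  -- `φ` covers `β := galTransporter m` on `Gal(k̄/k)` (abc-iut-w4-d047 `augLoc_transporterEquiv`; `transporterEnd = transporterEquiv` on elements)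
  let β : (AlgebraicClosure k ≃ₐ[k] AlgebraicClosure k) ≃* (AlgebraicClosure k ≃ₐ[k] AlgebraicClosure k) :=
    D.galTransporter D.PiXarrow (localToGF F k ι) hinj hH m
  have hβ : ∀ z, D.augLoc D.PiXarrow (localToGF F k ι) (φ z) = β (D.augLoc D.PiXarrow (localToGF F k ι) z) := fun z => by
    change D.augLoc D.PiXarrow (localToGF F k ι) (D.transporterEnd D.PiXarrow (localToGF F k ι) hinj m z) = _
    rw [D.transporterEnd_apply_eq_transporterEquiv]
    exact D.augLoc_transporterEquiv D.PiXarrow (localToGF F k ι) hinj hH m z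
  -- the anabelian σ's: `σ := σ_{m⁻¹}` is `β⁻¹`-equivariant, `σ' := σ_m` is `β`-equivariant, mutually inverse, both integral
  let σ : (AlgebraicClosure k)ˣ →* (AlgebraicClosure k)ˣ := (D.sigmaTransporter p k ι hinj hX m⁻¹).toMonoidHom
  let σ' : (AlgebraicClosure k)ˣ →* (AlgebraicClosure k)ˣ := (D.sigmaTransporter p k ι hinj hX m).toMonoidHom
  have hσ : ∀ (γ : AlgebraicClosure k ≃ₐ[k] AlgebraicClosure k) (y : (AlgebraicClosure k)ˣ), σ (γ • y) = β.symm γ • σ y :=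
    fun γ y => D.sigmaTransporter_smul_gal p k ι hinj hX m⁻¹ γ y
  have hσ' : ∀ (γ : AlgebraicClosure k ≃ₐ[k] AlgebraicClosure k) (y : (AlgebraicClosure k)ˣ), σ' (γ • y) = β γ • σ' y :=
    fun γ y => D.sigmaTransporter_smul_gal p k ι hinj hX m γ y
  have hσint : ∀ y : (AlgebraicClosure k)ˣ,
      @ValuativeRel.valuation (AlgebraicClosure k) _ (GaloisValDatum.ofComplete p k).valΩ (y : AlgebraicClosure k) ≤ 1 →
        @ValuativeRel.valuation (AlgebraicClosure k) _ (GaloisValDatum.ofComplete p k).valΩ (σ y : AlgebraicClosure k) ≤ 1 :=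
    fun y hy => D.sigmaTransporter_integral p k ι hinj hX m⁻¹ y hy
  have hσ'int : ∀ y : (AlgebraicClosure k)ˣ,
      @ValuativeRel.valuation (AlgebraicClosure k) _ (GaloisValDatum.ofComplete p k).valΩ (y : AlgebraicClosure k) ≤ 1 →
        @ValuativeRel.valuation (AlgebraicClosure k) _ (GaloisValDatum.ofComplete p k).valΩ (σ' y : AlgebraicClosure k) ≤ 1 :=
    fun y hy => D.sigmaTransporter_integral p k ι hinj hX m y hy
  have hinv : ∀ y, σ' (σ y) = y := fun y => by
    change D.sigmaTransporter p k ι hinj hX m (D.sigmaTransporter p k ι hinj hX m⁻¹ y) = y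
    rw [D.sigmaTransporter_inv p k ι hinj hX m, MulEquiv.apply_symm_apply]
  have hinv' : ∀ y, σ (σ' y) = y := fun y => by
    change D.sigmaTransporter p k ι hinj hX m⁻¹ (D.sigmaTransporter p k ι hinj hX m y) = y
    rw [D.sigmaTransporter_inv p k ι hinj hX m, MulEquiv.symm_apply_apply]
  -- the σ-lift over `pullSelfEquiv φ ψ`
  obtain ⟨Ψ, hΨ, ⟨i⟩⟩ := SigmaLift.exists_selfEquivalence_liesUnder_pullSelfEquiv (GaloisValDatum.ofComplete p k)
    (D.augLoc D.PiXarrow (localToGF F k ι)) (D.continuous_augLoc D.PiXarrow (localToGF F k ι))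
    (D.augLoc_PiXarrow_surjective k ι) (D.isOpenMap_augLoc D.PiXarrow (localToGF F k ι) hX (continuous_localToGF F k ι)) k
    (GaloisValDatum.p_mem_normVal p k) φ hφc (surj_of_comp_eq_id' h₁) β hβ σ hσ hσint ψ hψc h₁ h₂ σ' hσ' hσ'int hinv hinv'
  -- the five transport functors of `E ∘ conj_n ∘ E⁻¹` and their composite ON THE NOSE (abc-iut-L5-t16's computation)
  let Hx : Subgroup D.PiC := (D.localDataOfBadPairs CG hS M hA hI B ΛBad x).H
  let H' : Subgroup D.PiC := D.PiXarrow ⊓ (localToGF F k ι).range.comap D.augGF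
  let e := D.piLocEquiv D.PiXarrow (localToGF F k ι) hinj
  let a₁ : ↥H' →* ↥(D.PiLoc D.PiXarrow (localToGF F k ι)) := e.symm.toMonoidHom
  let a₂ : ↥Hx →* ↥H' := Subgroup.inclusion (le_of_eq hG)
  let c : ↥Hx →* ↥Hx := PiTransport.conjSub Hx n⁻¹
  let b₁ : ↥H' →* ↥Hx := Subgroup.inclusion (le_of_eq hG.symm)
  let b₂ : ↥(D.PiLoc D.PiXarrow (localToGF F k ι)) →* ↥H' := e.toMonoidHom
  have ha₁c : Continuous a₁ := D.continuous_piLocEquiv_symm D.PiXarrow (localToGF F k ι) hX (continuous_localToGF F k ι) hinj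
  have ha₁s : Function.Surjective a₁ := e.symm.surjective
  have ha₂c : Continuous a₂ := Continuous.subtype_mk continuous_subtype_val _
  have ha₂s : Function.Surjective a₂ := fun y =>
    ⟨⟨y.1, by change (y : D.PiC) ∈ (D.localDataOfBadPairs CG hS M hA hI B ΛBad x).H; rw [hG]; exact y.2⟩, rfl⟩
  have hcc : Continuous c := PiTransport.continuous_conjSub _ _
  have hcs : Function.Surjective c := surj_of_comp_eq_id' (PiTransport.conjSub_comp_inv Hx n⁻¹)
  have hb₁c : Continuous b₁ := Continuous.subtype_mk continuous_subtype_val _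
  have hb₁s : Function.Surjective b₁ := fun y =>
    ⟨⟨y.1, by change (y : D.PiC) ∈ D.PiXarrow ⊓ (localToGF F k ι).range.comap D.augGF; rw [← hG]; exact y.2⟩, rfl⟩
  have hb₂c : Continuous b₂ := D.continuous_piLocEquiv D.PiXarrow (localToGF F k ι) hinj
  have hb₂s : Function.Surjective b₂ := e.surjective
  have h12c : Continuous (a₁.comp a₂) := ha₁c.comp ha₂c
  have h12s : Function.Surjective (a₁.comp a₂) := ha₁s.comp ha₂s
  have h123c : Continuous ((a₁.comp a₂).comp c) := h12c.comp hcc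
  have h123s : Function.Surjective ((a₁.comp a₂).comp c) := h12s.comp hcs
  have h45c : Continuous (b₁.comp b₂) := hb₁c.comp hb₂c
  have h45s : Function.Surjective (b₁.comp b₂) := hb₁s.comp hb₂s
  have hallc : Continuous ((((a₁.comp a₂).comp c)).comp (b₁.comp b₂)) := h123c.comp h45c
  have halls : Function.Surjective ((((a₁.comp a₂).comp c)).comp (b₁.comp b₂)) := h123s.comp h45s
  have key : (((D.goodBaseEquiv CG hS M hA hI B ΛBad p k ι hinj hX x hG).trans (PiTransport.conjSelfEquiv _ n)).trans
      (D.goodBaseEquiv CG hS M hA hI B ΛBad p k ι hinj hX x hG).symm).functor = (PiTransport.pullSelfEquiv φ ψ hφc hψc h₁ h₂).functor := by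
    change ((CosetCat.pull a₁ ha₁c ha₁s ⋙ CosetCat.pull a₂ ha₂c ha₂s) ⋙ CosetCat.pull c hcc hcs) ⋙
      (CosetCat.pull b₁ hb₁c hb₁s ⋙ CosetCat.pull b₂ hb₂c hb₂s) = CosetCat.pull φ hφc (surj_of_comp_eq_id' h₁)
    rw [CosetCat.pull_comp a₁ ha₁c ha₁s a₂ ha₂c ha₂s h12c h12s, CosetCat.pull_comp (a₁.comp a₂) h12c h12s c hcc hcs h123c h123s,
      CosetCat.pull_comp b₁ hb₁c hb₁s b₂ hb₂c hb₂s h45c h45s,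
      CosetCat.pull_comp ((a₁.comp a₂).comp c) h123c h123s (b₁.comp b₂) h45c h45s hallc halls]
    refine CosetCat.pull_congr _ _ _ _ _ _ (MonoidHom.ext fun z => ?_)
    change e.symm (a₂ (c (b₁ (e z)))) = e.symm (PiTransport.conjSub _ m (e z))
    congr 1
  refine ⟨Ψ, ?_, ⟨i ≪≫ eqToIso (congrArg (fun G => (D.goodLocalFrobenioidOfEmb p k ι hX).toBase ⋙ G) key.symm)⟩⟩
  rw [key, hΨ]
  exact SigmaLift.lift_comp_toBase (GaloisValDatum.ofComplete p k) (D.augLoc D.PiXarrow (localToGF F k ι))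
    (D.continuous_augLoc D.PiXarrow (localToGF F k ι)) (D.augLoc_PiXarrow_surjective k ι)
    (D.isOpenMap_augLoc D.PiXarrow (localToGF F k ι) hX (continuous_localToGF F k ι)) k (GaloisValDatum.p_mem_normVal p k) φ hφc
    (surj_of_comp_eq_id' h₁) β hβ σ hσ hσint

variable (I : D.MergeInputs B) (hx : x ∉ D.indexCopyArc) (hxb : x ∉ D.indexCopyBad) [Fact (D.primeAt x hx).Prime]

omit [IsScalarTower F K Fbar] [Normal K Fbar] in
include hxb in
/-- **[IUTchI] Cor 5.3 (ii), SURJECTIVITY HALF AT THE GENUINE GOOD SLOT: `LiftsAll` IS A THEOREM.**  At racer C's `frobeniusGoodAt CG hA B I x hx`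
(good nonarchimedean index `x` of the merge term), EVERY ambient automorphism of the kit's `𝒟_v̲` (every transporter of `Π_v̲`, abc-iut-L5-t16
`goodLiftsAllAt_iff`) lifts to a §0-isomorphism of the genuine `𝒞_v̲` over it — print's «follows immediately from [AbsTopIII], Proposition 3.2, (iv)»
made kernel-exact: transporter automorphisms (★ p504734) + anabelian units transport (★ p505751 ⟸ L4 `unitsTransport_holds`) + [FrdII] Ex 1.1 (ii)
functoriality in multiplicative valuative isomorphisms (★ p507212) + the σ-lift (`GoodLocalFrobenioidSigmaLift`).  No FACT binder; binders = the kit's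
∪ {I, x, hx, hxb}. ([IUTchI] Cor 5.3 (ii) p.144) [claim: Mochizuki2012, status: disputed] -/
theorem liftsAll_goodStructureFunctorAt :
    letI := GaloisValDatum.normVal (D.KvAt x hx)
    CatIsomorphism.LiftsAll (D.goodStructureFunctorAt CG hS M hA hI B ΛBad I x hx hxb)
      ((D.baseKitThetaNFOfBadPairs CG hS M hA hI B ΛBad).model x) (D.modelAutToCatAut CG hS M hA hI B ΛBad x) := by
  haveI := D.isScalarTower
  haveI := D.normal_K
  letI := D.algebraKvAt x hx
  haveI := GaloisValDatum.finiteDimensional_rescaledCompletion K (D.primeAt x hx) (D.specAt x hx) (D.primeAt_mem x hx)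
  refine (D.goodLiftsAllAt_iff CG hS M hA hI B ΛBad I x hx hxb).mpr fun n => ?_
  obtain ⟨Ψ, -, h⟩ := D.exists_selfEquivalence_liesUnder_of_transporter CG hS M hA hI B ΛBad (D.primeAt x hx) (D.KvAt x hx)
    (localEmb (K := K) (Fbar := Fbar) (AlgebraicClosure (D.KvAt x hx))) (D.localToGF_injective_at x hx)
    (D.isOpen_PiXarrow_of_mergeInputs CG hA B I) x (D.localDataOfBadPairs_H_at CG hS M hA hI B ΛBad x hx hxb) n
  exact ⟨Ψ, h⟩

omit [IsScalarTower F K Fbar] [Normal K Fbar] in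
include hxb in
/-- **Consequence: the Cor 5.3 (ii) MODEL CASE at the (S1) slot of record («`α ↦ toD(α)` bijective on automorphisms of the reference object») is
EQUIVALENT to the single remaining input `RigidOverBase (frobeniusGoodAt …).toBase`** — print's injectivity half (the [FrdI]-level rigidity rows);
the surjectivity half is discharged by `liftsAll_goodStructureFunctorAt` (abc-iut-L5-t16 `goodLiftAt_model_case_iff`, ★ p498387).
([IUTchI] Cor 5.3 (ii) p.144) [claim: Mochizuki2012, status: disputed] -/
theorem goodLiftAt_model_case_iff_rigidOverBase :
    letI := GaloisValDatum.normVal (D.KvAt x hx)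
    Function.Bijective (fun α : SingleObj.star _ ≅ SingleObj.star _ =>
        (show (D.baseKitThetaNFOfBadPairs CG hS M hA hI B ΛBad).model x ≅ (D.baseKitThetaNFOfBadPairs CG hS M hA hI B ΛBad).model x from
          (D.goodLiftToDAt CG hS M hA hI B ΛBad I x hx hxb).mapIso α)) ↔
      CatIsomorphism.RigidOverBase (D.frobeniusGoodAt CG hA B I x hx).toBase := by
  rw [D.goodLiftAt_model_case_iff CG hS M hA hI B ΛBad I x hx hxb]
  exact ⟨fun h => h.2, fun h => ⟨D.liftsAll_goodStructureFunctorAt CG hS M hA hI B ΛBad x I hx hxb, h⟩⟩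

end AtTerm

/-! ### §C. The same at GENERIC place data `(p, k, ι, hinj, hX, hG)`: `LiftsAll` for `goodStructureFunctor`, and the model case at the
upgraded good slot `goodLiftToD` ↔ `RigidOverBase (D.goodLocalFrobenioidOfEmb p k ι hX).toBase` (v2 APPEND; consumers with place plumbing
other than racer C's `primeAt/KvAt/localEmb` — e.g. a kit over another completed-place presentation — read the surjectivity half here) -/

section PlaceData

variable {F K Fbar : Type} [Field F] [NumberField F] [Field K] [NumberField K] [Algebra F K]
  [Field Fbar] [Algebra F Fbar] [Algebra K Fbar]
  {E : WeierstrassCurve F} [E.IsElliptic] {l : ℕ} {Pb : BadPlacePredicates K}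
  (D : InitialThetaData F K Fbar E l Pb) (CG : D.geom.pe.CuspGalois) (hS : D.CuspClassesNormaliserStable) [Fact l.Prime]
  (M : D.TorsionMonodromy) (hA : D.geom.pe.ArrowCoveringClaims)
  (hI : ∀ k ∈ D.geom.pe.inertia D.geom.pe.ε1, M.tau (D.geom.embK k) = 0)
  (B : ∀ v, v ∈ D.indexCopyBad → D.BadPairAt v) (ΛBad : ∀ v (h : v ∈ D.indexCopyBad), D.LocalArrowLaw CG hS (B v h).H)
  (p : ℕ) [Fact p.Prime] (k : Type) [NontriviallyNormedField k] [CompleteSpace k] [IsUltrametricDist k]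
  [NormedAlgebra ℚ_[p] k] [FiniteDimensional ℚ_[p] k] [Algebra K k] (ι : Fbar →ₐ[K] AlgebraicClosure k)
  [IsScalarTower F K Fbar] [Normal K Fbar]
  (hinj : Function.Injective (localToGF F k ι)) (hX : IsOpen (D.PiXarrow : Set D.PiC)) (x : D.IndexCopy)
  (hG : (D.localDataOfBadPairs CG hS M hA hI B ΛBad x).H = D.PiXarrow ⊓ (localToGF F k ι).range.comap D.augGF)

/-- **`LiftsAll` AT GENERIC PLACE DATA.**  For ANY presentation of the good place — a prime `p`, a finite extension `k/ℚ_p` with `K → k`,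
an embedding `ι : F̄ → k̄` over `K` with `localToGF` injective, `Π_{X̲→_K}` open, and the seam equation `hG` identifying the kit's `Π_v̲` with
`Π_{X̲→_K} ∩ augGF⁻¹(G_v̲)` — EVERY ambient automorphism of the kit's `𝒟_v̲` lifts to a §0-isomorphism of the genuine
`𝒞_v̲ = (D.goodLocalFrobenioidOfEmb p k ι hX).Cv` through `goodStructureFunctor` (abc-iut-L5-t16 ★ p498387): one self-equivalence per transporter
(`exists_selfEquivalence_liesUnder_of_transporter`), read through abc-iut-L5-t16's `PiTransport.liftsAll_thetaAmb_iff` and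
`CatIsomorphism.nonempty_liesUnder_comp_equivalence_iff` (★ p501097) exactly as `liftsAll_goodStructureFunctorAt` is at racer C's term data.  No FACT
binder. ([IUTchI] Cor 5.3 (ii) p.144) [claim: Mochizuki2012, status: disputed] -/
theorem liftsAll_goodStructureFunctor :
    letI := GaloisValDatum.normVal k
    CatIsomorphism.LiftsAll (D.goodStructureFunctor CG hS M hA hI B ΛBad p k ι hinj hX x hG)
      ((D.baseKitThetaNFOfBadPairs CG hS M hA hI B ΛBad).model x) (D.modelAutToCatAut CG hS M hA hI B ΛBad x) := by
  letI := GaloisValDatum.normVal k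
  haveI := M.normal_PiXund_subgroupOf_PiXK
  rw [modelAutToCatAut_eq]
  refine (PiTransport.liftsAll_thetaAmb_iff D.augGF _ _ _).mpr fun n => ?_
  obtain ⟨Ψ, -, h⟩ := D.exists_selfEquivalence_liesUnder_of_transporter CG hS M hA hI B ΛBad p k ι hinj hX x hG n
  exact ⟨Ψ, (CatIsomorphism.nonempty_liesUnder_comp_equivalence_iff _ _ Ψ _).mpr h⟩

/-- **Consequence at generic place data**: the Cor 5.3 (ii) MODEL CASE at the upgraded good slot `goodLiftToD` (abc-iut-L5-t16
`goodLift_model_case_iff`, ★ p498387: «`α ↦ toD(α)` bijective» ↔ `LiftsAll ∧ RigidOverBase`) is EQUIVALENT to the single input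
`RigidOverBase (D.goodLocalFrobenioidOfEmb p k ι hX).toBase` — print's injectivity half, VERBATIM the conclusion of abc-iut-L1-t7's
`Cor53iiAtGoodPlaceOfBaseIso` chain as re-exported in abc-iut-L5-t16's `rigidOverBase_goodLocalFrobenioidOfEmb_of_facts`; the surjectivity half is
`liftsAll_goodStructureFunctor`. ([IUTchI] Cor 5.3 (ii) p.144) [claim: Mochizuki2012, status: disputed] -/
theorem goodLift_model_case_iff_rigidOverBase :
    letI := GaloisValDatum.normVal k
    Function.Bijective (fun α : SingleObj.star ↥(D.goodLiftSubgroup CG hS M hA hI B ΛBad p k ι hinj hX x hG) ≅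
        SingleObj.star ↥(D.goodLiftSubgroup CG hS M hA hI B ΛBad p k ι hinj hX x hG) =>
        (show (D.baseKitThetaNFOfBadPairs CG hS M hA hI B ΛBad).model x ≅ (D.baseKitThetaNFOfBadPairs CG hS M hA hI B ΛBad).model x from
          (D.goodLiftToD CG hS M hA hI B ΛBad p k ι hinj hX x hG).mapIso α)) ↔
      CatIsomorphism.RigidOverBase (D.goodLocalFrobenioidOfEmb p k ι hX).toBase := by
  rw [D.goodLift_model_case_iff CG hS M hA hI B ΛBad p k ι hinj hX x hG]
  exact ⟨fun h => h.2, fun h => ⟨D.liftsAll_goodStructureFunctor CG hS M hA hI B ΛBad p k ι hinj hX x hG, h⟩⟩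

/-- **The model case at generic place data from the two DISPLAYED halves' single survivor**: given `RigidOverBase` of the genuine `𝒞_v̲`
over its own base (hypothesis `hrig` — discharged modulo the frozen FACTS F-1979/F-0004 by abc-iut-L5-t16's
`rigidOverBase_goodLocalFrobenioidOfEmb_of_facts`, which imports THIS file and therefore is not imported here), «`α ↦ toD(α)`» is bijective.
([IUTchI] Cor 5.3 (ii) p.144) [claim: Mochizuki2012, status: disputed] -/
theorem goodLift_model_case_of_rigidOverBase
    (hrig : letI := GaloisValDatum.normVal k
      CatIsomorphism.RigidOverBase (D.goodLocalFrobenioidOfEmb p k ι hX).toBase) :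
    letI := GaloisValDatum.normVal k
    Function.Bijective (fun α : SingleObj.star ↥(D.goodLiftSubgroup CG hS M hA hI B ΛBad p k ι hinj hX x hG) ≅
        SingleObj.star ↥(D.goodLiftSubgroup CG hS M hA hI B ΛBad p k ι hinj hX x hG) =>
        (show (D.baseKitThetaNFOfBadPairs CG hS M hA hI B ΛBad).model x ≅ (D.baseKitThetaNFOfBadPairs CG hS M hA hI B ΛBad).model x from
          (D.goodLiftToD CG hS M hA hI B ΛBad p k ι hinj hX x hG).mapIso α)) :=
  (D.goodLift_model_case_iff_rigidOverBase CG hS M hA hI B ΛBad p k ι hinj hX x hG).mpr hrig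

end PlaceData

end InitialThetaData

end Literature.IUT.HodgeTheaters

end
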